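import Literature.Barriers.RiemannHypothesis.NewmanConjecture
import Literature.NumberTheory.LFunctions.DeBruijnNewmanConstProofs
import Literature.NumberTheory.LFunctions.DobnerLemma4Proofs
import HarnessLib

/-!
# Barrier `NewmanConjecture` — proofs: `Λ ≥ 0` is a theorem of the tree, so de Bruijn's route is closed

Barrier catalogue `Literature/Barriers/RiemannHypothesis/` (D-0021), proofs companion of
`NewmanConjecture.lean` (namespace `Literature.Barriers.RiemannHypothesis`). No new definitions: this file
discharges the catalogued barrier `NewmanConjecture` (Rodgers–Tao 2020, **Theorem 1.1**: "One has
`Λ ≥ 0`", p. 3 of arXiv:1801.05914) and records the consequences for the technique it closes.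

## What is proved, and from what

* `NewmanConjecture_holds : NewmanConjecture` — for every `t < 0` the function `H_t` has a non-real
  zero, i.e. `¬ DeBruijnRoute`. It is `NewmanConjecture_of_rodgers_tao` applied to the tree's theorem
  `Literature.NumberTheory.LFunctions.rodgers_tao_holds` (`Literature/NumberTheory/LFunctions/DobnerLemma4Proofs.lean`), which
  proves the `sInf`-free form `∀ t < 0, ¬ HasOnlyRealZeros (H_t)` of Theorem 1.1 along Dobner's route
  [Dobner2020] (steepest descent for the heat-flow deformation of `ξ`, Bohr almost periodicity, a zero
  of the deformed `ζ`, Hurwitz), all of whose inputs are theorems of this library.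
* `not_deBruijnRoute : ¬ DeBruijnRoute` and `deBruijnRoute_iff_false` — **the technique-class
  definition `DeBruijnRoute` ("`H_t` has only real zeros for some `t < 0`", i.e. `Λ < 0`) is refuted**;
  it is the route the barrier closes, not a claim of the source, and no `DeBruijnRoute_holds` can exist.
* `not_hasOnlyRealZeros_deBruijnH_of_neg` — the pointwise form: `t < 0 → H_t` has a non-real zero.
* `deBruijnNewmanConst_nonneg : 0 ≤ Literature.deBruijnNewmanConst` — Theorem 1.1 in the `sInf` form
  (`Λ = sInf {t | H_t has only real zeros}`), now unconditional: the nonemptiness input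
  `Literature.NumberTheory.LFunctions.hasOnlyRealZeros_deBruijnH_one_half` (de Bruijn, `Λ ≤ 1/2`) is the tree's theorem
  `Literature.NumberTheory.LFunctions.hasOnlyRealZeros_deBruijnH_one_half_holds` (`DeBruijnNewmanConstProofs.lean`).
* `riemannHypothesis_iff_deBruijnNewmanConst_eq_zero : RiemannHypothesis ↔ Λ = 0` — "if the Riemann
  hypothesis is true, it is only 'barely so'" (§1, p. 3), unconditional, from the tree's
  `Literature.NumberTheory.LFunctions.riemannHypothesis_iff_deBruijnNewmanConst_eq_zero_of_rodgers_tao`.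
* `riemannHypothesis_of_deBruijnRoute'` — the route's implication `DeBruijnRoute → RH` of
  `NewmanConjecture.lean` with both hypotheses (`Literature.NumberTheory.LFunctions.HasOnlyRealZeros.mono_deBruijnH`,
  `Literature.NumberTheory.LFunctions.riemannHypothesis_iff_hasOnlyRealZeros_deBruijnH_zero`) fed their discharges; vacuous in view
  of `not_deBruijnRoute`, recorded so that no conditional form of the route remains open.

## References

* [RodgersTaoFMP2020] B. Rodgers, T. Tao, *The de Bruijn–Newman constant is non-negative*, Forum Math.
  Pi 8 (2020), e6 = arXiv:1801.05914, §1 (p. 3: "The Riemann hypothesis is then clearly equivalent to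
  the upper bound `Λ ≤ 0`"; Theorem 1.1 "One has `Λ ≥ 0`").
* [Dobner2020] A. Dobner, *A proof of Newman's conjecture for the extended Selberg class*,
  arXiv:2005.05142 = Acta Arith. 201 (2021), Thm. 2 (the route formalised under
  `Literature/NumberTheory/LFunctions/Dobner*.lean`).
-/

noncomputable section

namespace Literature.Barriers.RiemannHypothesis

/-- **Discharge of the barrier `NewmanConjecture`** (Rodgers–Tao 2020, Theorem 1.1: "One has
`Λ ≥ 0`"), i.e. `¬ DeBruijnRoute`: for every `t < 0` the function `H_t` has a non-real zero. From the
tree's theorem `Literature.NumberTheory.LFunctions.rodgers_tao_holds` (the `sInf`-free form of Theorem 1.1, proved along Dobner's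
route) through `NewmanConjecture_of_rodgers_tao`. [cite: RodgersTaoFMP2020, Theorem 1.1] -/
theorem NewmanConjecture_holds : NewmanConjecture :=
  NewmanConjecture_of_rodgers_tao Literature.NumberTheory.LFunctions.rodgers_tao_holds

/-- **de Bruijn's route is refuted** (`Λ < 0` is false): there is no `t < 0` for which `H_t` has
only real zeros. `DeBruijnRoute` is the technique-class definition closed by the barrier, not a
dischargeable fact — a `DeBruijnRoute_holds` would contradict this theorem.
[cite: RodgersTaoFMP2020, Theorem 1.1] -/
theorem not_deBruijnRoute : ¬ DeBruijnRoute :=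
  NewmanConjecture_holds

/-- `DeBruijnRoute ↔ False` (Theorem 1.1 restated for rewriting). [cite: RodgersTaoFMP2020, Theorem 1.1] -/
theorem deBruijnRoute_iff_false : DeBruijnRoute ↔ False :=
  iff_false_intro not_deBruijnRoute

/-- Pointwise form of Theorem 1.1 (`Λ ≥ 0`): for every `t < 0`, `H_t` does **not** have only real
zeros. [cite: RodgersTaoFMP2020, Theorem 1.1] -/
theorem not_hasOnlyRealZeros_deBruijnH_of_neg {t : ℝ} (ht : t < 0) :
    ¬ Literature.NumberTheory.LFunctions.HasOnlyRealZeros (Literature.NumberTheory.LFunctions.deBruijnH t) :=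
  Literature.NumberTheory.LFunctions.rodgers_tao_holds t ht

/-- **`Λ ≥ 0`** (Rodgers–Tao 2020, Theorem 1.1) in the `sInf` form
`Literature.deBruijnNewmanConst = sInf {t | H_t has only real zeros}`, unconditionally: the barrier
(`NewmanConjecture_holds`) and de Bruijn's nonemptiness input `H_{1/2}` has only real zeros
(`Literature.NumberTheory.LFunctions.hasOnlyRealZeros_deBruijnH_one_half_holds`). [cite: RodgersTaoFMP2020, Theorem 1.1] -/
theorem deBruijnNewmanConst_nonneg : 0 ≤ Literature.NumberTheory.LFunctions.deBruijnNewmanConst :=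
  deBruijnNewmanConst_nonneg_of_NewmanConjecture NewmanConjecture_holds
    Literature.NumberTheory.LFunctions.hasOnlyRealZeros_deBruijnH_one_half_holds

/-- **"If the Riemann hypothesis is true, it is only 'barely so'"** (Rodgers–Tao 2020, §1 with
Theorem 1.1): `RH ↔ Λ = 0`, unconditionally (`RH ↔ Λ ≤ 0` is de Bruijn–Newman, `Λ ≥ 0` is
Theorem 1.1); the tree's `Literature.NumberTheory.LFunctions.riemannHypothesis_iff_deBruijnNewmanConst_eq_zero_of_rodgers_tao` fed
`Literature.NumberTheory.LFunctions.rodgers_tao_holds`. [cite: RodgersTaoFMP2020, §1 and Theorem 1.1] -/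
theorem riemannHypothesis_iff_deBruijnNewmanConst_eq_zero :
    RiemannHypothesis ↔ Literature.NumberTheory.LFunctions.deBruijnNewmanConst = 0 :=
  Literature.NumberTheory.LFunctions.riemannHypothesis_iff_deBruijnNewmanConst_eq_zero_of_rodgers_tao Literature.NumberTheory.LFunctions.rodgers_tao_holds

/-- The route's implication `DeBruijnRoute → RH` (`riemannHypothesis_of_deBruijnRoute`) with its two
hypotheses discharged by the tree's theorems `Literature.NumberTheory.LFunctions.HasOnlyRealZeros.mono_deBruijnH_holds` (de Bruijn's
monotonicity) and `Literature.NumberTheory.LFunctions.riemannHypothesis_iff_hasOnlyRealZeros_deBruijnH_zero_holds` (`RH ↔ H_0` has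
only real zeros). Vacuous in view of `not_deBruijnRoute`; recorded so that no conditional form of the
route remains. [cite: RodgersTaoFMP2020, §1] -/
theorem riemannHypothesis_of_deBruijnRoute' : DeBruijnRoute → RiemannHypothesis :=
  riemannHypothesis_of_deBruijnRoute Literature.NumberTheory.LFunctions.HasOnlyRealZeros.mono_deBruijnH_holds
    Literature.NumberTheory.LFunctions.riemannHypothesis_iff_hasOnlyRealZeros_deBruijnH_zero_holds

end Literature.Barriers.RiemannHypothesis
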